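import Summits.AtomisticToContinuum.BoseEinsteinCondensation.Theses.BECStronglyRayleigh
import Summits.AtomisticToContinuum.BoseEinsteinCondensation.Theorems.BECStronglyRayleighGroundStateStabilityConeSelection
import Literature.MathematicalPhysics.QuantumLattice.TraceInequalitiesProofs
import HarnessLib

/-!
# Trotter closure: stub `stub_trotterClosure` of line `stable-cone-variational-selection`
# for crux `GroundStateStability` (stmt-AtomisticToContinuum-9672)

Stub C (the transfer `C⁺`, Borcea–Brändén–Liggett 2009, Prop. 5.1 architecture) of the skeleton
`Cruxes/GroundStateStability/Lines/stable-cone-variational-selection.lean`: IF every one-bond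
semigroup `exp(t B_xy)`, `B_xy = S¹_xS¹_y + S²_xS²_y + Δ S³_xS³_y` (`t ≥ 0`, `|Δ| ≤ 1`, `x ≠ y`), and
every one-site semigroup `exp(t c S³_x)` maps coefficient vectors with upper-half-plane-stable
occupation polynomial `Σ_S φ(1_S) z^S` to such vectors, THEN so does the Gibbs semigroup `e^{-τH}`,
`τ ≥ 0`, of `H = xxzHamiltonian 1 G (-1) Δ + Σ_x μ_x S³_x` on every finite graph with every real field.

Proof (finite-dimensional, no norms in statements).
* Abstract semigroup-preserver closure over `Matrix ι ι ℂ` for an arbitrary property `P` of vectors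
  whose "`0` or `P`" set is closed and with `¬ P 0`: preservers of `P` contain `1` and are closed
  under products and powers (`trotter_pres_one/_mul/_pow`); an INVERTIBLE limit of preservers is a
  preserver (`trotter_pres_of_tendsto`: the image vectors converge by continuity of `M ↦ M φ`,
  the limit vector is `0` or `P` by closedness, and `0` is excluded by injectivity); hence the
  generators of `P`-preserving semigroups `{X | ∀ t ≥ 0, exp(tX) preserves P}` are closed under
  `+` (`trotter_semigroup_add`, by the Lie product formula
  `Literature.MathematicalPhysics.QuantumLattice.lieTrotter_productFormula_holds` and
  `Matrix.isUnit_exp`), contain `0`, and are closed under finite sums (`trotter_semigroup_sum`).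
* For `P` = "stable occupation polynomial" the two inputs are the landed
  `coneSel_isClosed_zero_or_stable` (multivariate Hurwitz) and `coneSel_ne_zero_of_stable`.
* `-τH = τ • (Σ_{e ∈ E(G)} B_e + Σ_x (-μ_x) S³_x)` (`trotter_exponent_eq`, `J = -1`); every edge
  `e = s(x, y)` has `x ≠ y`, so each `B_e` is a generator by hypothesis 1 and each `(-μ_x) S³_x` by
  hypothesis 2.
-/

namespace Summit.AtomisticToContinuum.BoseEinsteinCondensation.Cruxes.GroundStateStability.StableConeVariationalSelection

open scoped BigOperators Matrix ComplexOrder Topology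
open Literature.MathematicalPhysics.QuantumLattice
open Filter

/-! ### Abstract closure properties of `P`-preserving matrices and semigroups -/

section Abstract

variable {ι : Type*} [Fintype ι] [DecidableEq ι] (P : (ι → ℂ) → Prop)

/-- The identity matrix preserves any property of vectors. [folklore] -/
theorem trotter_pres_one : ∀ φ : ι → ℂ, P φ → P ((1 : Matrix ι ι ℂ) *ᵥ φ) := fun φ hφ => by
  rwa [Matrix.one_mulVec]

omit [DecidableEq ι] in
/-- Preservers of a property of vectors are closed under matrix products. [folklore] -/
theorem trotter_pres_mul {M N : Matrix ι ι ℂ} (hM : ∀ φ : ι → ℂ, P φ → P (M *ᵥ φ))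
    (hN : ∀ φ : ι → ℂ, P φ → P (N *ᵥ φ)) : ∀ φ : ι → ℂ, P φ → P ((M * N) *ᵥ φ) :=
  fun φ hφ => by
  rw [← Matrix.mulVec_mulVec]
  exact hM _ (hN _ hφ)

/-- Preservers of a property of vectors are closed under powers. [folklore] -/
theorem trotter_pres_pow {M : Matrix ι ι ℂ} (hM : ∀ φ : ι → ℂ, P φ → P (M *ᵥ φ)) (k : ℕ) :
    ∀ φ : ι → ℂ, P φ → P ((M ^ k) *ᵥ φ) := by
  induction k with
  | zero =>
    rw [pow_zero]
    exact trotter_pres_one P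
  | succ k ih =>
    rw [pow_succ]
    exact trotter_pres_mul P ih hM

/-- **Closedness step.** If "`0` or `P`" is a closed set of vectors and `P 0` fails, then an
invertible limit `M` of a sequence of `P`-preserving matrices preserves `P`: for `P φ` the vectors
`u_s φ → M φ` all satisfy `P`, so `M φ = 0 ∨ P (M φ)`, and `M φ = 0` would force `φ = 0`. [folklore] -/
theorem trotter_pres_of_tendsto (hcl : IsClosed {v : ι → ℂ | v = 0 ∨ P v}) (h0 : ¬ P 0)
    {u : ℕ → Matrix ι ι ℂ} {M : Matrix ι ι ℂ} (hu : ∀ s, ∀ φ : ι → ℂ, P φ → P (u s *ᵥ φ))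
    (hlim : Tendsto u atTop (𝓝 M)) (hM : IsUnit M) : ∀ φ : ι → ℂ, P φ → P (M *ᵥ φ) := by
  intro φ hφ
  have hv : Tendsto (fun s => u s *ᵥ φ) atTop (𝓝 (M *ᵥ φ)) :=
    ((continuous_id.matrix_mulVec continuous_const).tendsto M).comp hlim
  have hmem : M *ᵥ φ ∈ {v : ι → ℂ | v = 0 ∨ P v} :=
    hcl.mem_of_tendsto hv (Eventually.of_forall fun s => Or.inr (hu s φ hφ))
  rcases hmem with h | h
  · have hinj := Matrix.mulVec_injective_iff_isUnit.mpr hM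
    have hφ0 : φ = 0 := hinj (h.trans (Matrix.mulVec_zero M).symm)
    exact absurd (hφ0 ▸ hφ) h0
  · exact h

/-- **Lie–Trotter step** (Borcea–Brändén–Liggett 2009, proof of Prop. 5.1): if the semigroups
`exp(tX)` and `exp(tY)` (`t ≥ 0`) preserve `P`, so does `exp(t(X+Y))`, because
`exp(t(X+Y)) = lim_s (exp(tX/s) exp(tY/s))^s` (tree `lieTrotter_productFormula_holds`), each term
preserves `P`, "`0` or `P`" is closed and `exp` is invertible (`Matrix.isUnit_exp`).
[cite: BorceaBrandenLiggett2008, Proposition 5.1] -/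
theorem trotter_semigroup_add (hcl : IsClosed {v : ι → ℂ | v = 0 ∨ P v}) (h0 : ¬ P 0)
    {X Y : Matrix ι ι ℂ}
    (hX : ∀ t : ℝ, 0 ≤ t → ∀ φ : ι → ℂ, P φ → P (NormedSpace.exp ((t : ℂ) • X) *ᵥ φ))
    (hY : ∀ t : ℝ, 0 ≤ t → ∀ φ : ι → ℂ, P φ → P (NormedSpace.exp ((t : ℂ) • Y) *ᵥ φ)) :
    ∀ t : ℝ, 0 ≤ t → ∀ φ : ι → ℂ, P φ → P (NormedSpace.exp ((t : ℂ) • (X + Y)) *ᵥ φ) := by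
  intro t ht
  have hlim := lieTrotter_productFormula_holds (𝕜 := ℂ) (n := ι) ((t : ℂ) • X) ((t : ℂ) • Y)
  rw [← smul_add] at hlim
  refine trotter_pres_of_tendsto P hcl h0 (fun s => ?_) hlim (Matrix.isUnit_exp _)
  have hsc : ∀ Z : Matrix ι ι ℂ, (s : ℂ)⁻¹ • ((t : ℂ) • Z) = (((s : ℝ)⁻¹ * t : ℝ) : ℂ) • Z :=
    fun Z => by
    rw [smul_smul, Complex.ofReal_mul, Complex.ofReal_inv, Complex.ofReal_natCast]
  have hst : 0 ≤ (s : ℝ)⁻¹ * t := mul_nonneg (inv_nonneg.mpr s.cast_nonneg) ht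
  rw [hsc X, hsc Y]
  exact trotter_pres_pow P (trotter_pres_mul P (hX _ hst) (hY _ hst)) s

/-- The trivial semigroup `exp(t • 0) = 1` preserves `P`. [folklore] -/
theorem trotter_semigroup_zero :
    ∀ t : ℝ, 0 ≤ t → ∀ φ : ι → ℂ, P φ →
      P (NormedSpace.exp ((t : ℂ) • (0 : Matrix ι ι ℂ)) *ᵥ φ) := by
  intro t _ φ hφ
  rwa [smul_zero, NormedSpace.exp_zero, Matrix.one_mulVec]

/-- **Finite sums of generators.** If each `exp(t f_a)` (`t ≥ 0`, `a ∈ s`) preserves `P`, "`0` or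
`P`" is closed and `¬ P 0`, then `exp(t Σ_{a ∈ s} f_a)` preserves `P` (induction on `s` with the
Lie–Trotter step). [cite: BorceaBrandenLiggett2008, Proposition 5.1] -/
theorem trotter_semigroup_sum (hcl : IsClosed {v : ι → ℂ | v = 0 ∨ P v}) (h0 : ¬ P 0)
    {α : Type*} (s : Finset α) (f : α → Matrix ι ι ℂ)
    (hf : ∀ a ∈ s, ∀ t : ℝ, 0 ≤ t → ∀ φ : ι → ℂ, P φ →
      P (NormedSpace.exp ((t : ℂ) • f a) *ᵥ φ)) :
    ∀ t : ℝ, 0 ≤ t → ∀ φ : ι → ℂ, P φ →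
      P (NormedSpace.exp ((t : ℂ) • ∑ a ∈ s, f a) *ᵥ φ) := by
  classical
  induction s using Finset.induction_on with
  | empty =>
    rw [Finset.sum_empty]
    exact trotter_semigroup_zero P
  | insert a s ha ih =>
    rw [Finset.sum_insert ha]
    exact trotter_semigroup_add P hcl h0 (hf a (Finset.mem_insert_self a s))
      (ih fun b hb => hf b (Finset.mem_insert_of_mem hb))

end Abstract

/-! ### The exponent `-τH` as a nonnegative combination of bond and site generators -/

/-- Bookkeeping for `J = -1`: `-τ • ((-1) • Σ_e F_e + Σ_x μ_x • S_x) = τ • (Σ_e F_e + Σ_x (-μ_x) • S_x)`.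
[folklore] -/
theorem trotter_exponent_eq {Λ : Type*} [Fintype Λ] {V : Type*} [AddCommGroup V] [Module ℂ V]
    (τ : ℝ) (E : Finset (Sym2 Λ)) (F : Sym2 Λ → V) (μ : Λ → ℝ) (S : Λ → V) :
    -(τ : ℂ) • (((-1 : ℝ) : ℂ) • ∑ e ∈ E, F e + ∑ x : Λ, ((μ x : ℝ) : ℂ) • S x) =
      (τ : ℂ) • (∑ e ∈ E, F e + ∑ x : Λ, ((-μ x : ℝ) : ℂ) • S x) := by
  have hS : (∑ x : Λ, ((-μ x : ℝ) : ℂ) • S x) = -∑ x : Λ, ((μ x : ℝ) : ℂ) • S x := by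
    rw [← Finset.sum_neg_distrib]
    refine Finset.sum_congr rfl fun x _ => ?_
    rw [Complex.ofReal_neg, neg_smul]
  rw [hS, Complex.ofReal_neg, Complex.ofReal_one, neg_one_smul, neg_smul, smul_add, smul_add,
    smul_neg, smul_neg, neg_add, neg_neg]

/-! ### The stub -/

/-- **Stub C — Trotter closure: the XXZ Gibbs semigroup is a preserver (transfer `C⁺`).** If
every bond factor `e^{tB_xy}` (`t ≥ 0`, `|Δ| ≤ 1`) and every site factor `e^{tcS³_x}` preserves
stability, then so does `e^{-τH}`, `H = xxzHamiltonian 1 G (-1) Δ + Σ μ_x S³_x`, for every finite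
graph, every real field and every `τ ≥ 0`: `-τH = τ(Σ_e B_e + Σ_x (-μ_x)S³_x)`; induction over the
two finite sums with the two-factor Lie product formula
(`Literature.MathematicalPhysics.QuantumLattice.lieTrotter_productFormula_holds`), closedness of
"`0` or stable" (`coneSel_isClosed_zero_or_stable`) at each step, and `Matrix.isUnit_exp` to exclude
the zero alternative (BBL2009 Prop. 5.1 architecture). [cite: BorceaBrandenLiggett2008, Proposition 5.1] -/
theorem stub_trotterClosure :
    (∀ (Λ : Type) [Fintype Λ] [DecidableEq Λ] (x y : Λ), x ≠ y → ∀ (Δ t : ℝ), |Δ| ≤ 1 → 0 ≤ t →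
      ∀ φ : TensorIndex Λ 2 → ℂ,
        (∀ z : Λ → ℂ, (∀ i, 0 < (z i).im) →
          (∑ S : Finset Λ, φ (fun i => if i ∈ S then 0 else 1) * ∏ i ∈ S, z i) ≠ 0) →
        (∀ z : Λ → ℂ, (∀ i, 0 < (z i).im) →
          (∑ S : Finset Λ, (NormedSpace.exp ((t : ℂ) • (spinBond 1 0 x y + spinBond 1 1 x y + (Δ : ℂ) • spinBond 1 2 x y)) *ᵥ φ) (fun i => if i ∈ S then 0 else 1) * ∏ i ∈ S, z i) ≠ 0)) →
    (∀ (Λ : Type) [Fintype Λ] [DecidableEq Λ] (x : Λ) (c t : ℝ),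
      ∀ φ : TensorIndex Λ 2 → ℂ,
        (∀ z : Λ → ℂ, (∀ i, 0 < (z i).im) →
          (∑ S : Finset Λ, φ (fun i => if i ∈ S then 0 else 1) * ∏ i ∈ S, z i) ≠ 0) →
        (∀ z : Λ → ℂ, (∀ i, 0 < (z i).im) →
          (∑ S : Finset Λ, (NormedSpace.exp ((t : ℂ) • ((c : ℂ) • siteSpin 1 x 2)) *ᵥ φ) (fun i => if i ∈ S then 0 else 1) * ∏ i ∈ S, z i) ≠ 0)) →
    (∀ (Λ : Type) [Fintype Λ] [DecidableEq Λ] (G : SimpleGraph Λ) [DecidableRel G.Adj] (Δ : ℝ) (μ : Λ → ℝ),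
      |Δ| ≤ 1 → ∀ τ : ℝ, 0 ≤ τ →
      ∀ φ : TensorIndex Λ 2 → ℂ,
        (∀ z : Λ → ℂ, (∀ i, 0 < (z i).im) →
          (∑ S : Finset Λ, φ (fun i => if i ∈ S then 0 else 1) * ∏ i ∈ S, z i) ≠ 0) →
        (∀ z : Λ → ℂ, (∀ i, 0 < (z i).im) →
          (∑ S : Finset Λ, (Matrix.gibbsWeight τ (xxzHamiltonian 1 G (-1) Δ + ∑ x : Λ, ((μ x : ℝ) : ℂ) • siteSpin 1 x 2) *ᵥ φ) (fun i => if i ∈ S then 0 else 1) * ∏ i ∈ S, z i) ≠ 0)) := by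
  intro hbond hsite Λ _ _ G _ Δ μ hΔ τ hτ
  -- the property `P` = "stable occupation polynomial", its closedness input and `¬ P 0`
  have hcl : IsClosed {v : TensorIndex Λ 2 → ℂ | v = 0 ∨
      (fun φ : TensorIndex Λ 2 → ℂ => ∀ z : Λ → ℂ, (∀ i, 0 < (z i).im) →
        (∑ S : Finset Λ, φ (fun i => if i ∈ S then 0 else 1) * ∏ i ∈ S, z i) ≠ 0) v} :=
    coneSel_isClosed_zero_or_stable Λ
  have h0 : ¬ (fun φ : TensorIndex Λ 2 → ℂ => ∀ z : Λ → ℂ, (∀ i, 0 < (z i).im) →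
        (∑ S : Finset Λ, φ (fun i => if i ∈ S then 0 else 1) * ∏ i ∈ S, z i) ≠ 0) 0 :=
    fun h => coneSel_ne_zero_of_stable h rfl
  -- rewrite the exponent `-τH` as `τ • (Σ_e B_e + Σ_x (-μ_x) S³_x)`
  unfold Matrix.gibbsWeight xxzHamiltonian
  rw [trotter_exponent_eq]
  refine trotter_semigroup_add _ hcl h0
    (trotter_semigroup_sum _ hcl h0 _ _ fun e he => ?_)
    (trotter_semigroup_sum _ hcl h0 _ _ fun x _ t _ => hsite Λ x (-μ x) t) τ hτ
  -- bond generators: every edge `e = s(x, y)` of `G` has `x ≠ y`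
  induction e using Sym2.ind with
  | h x y =>
    rw [SimpleGraph.mem_edgeFinset, SimpleGraph.mem_edgeSet] at he
    rw [Sym2.lift_mk]
    exact fun t ht => hbond Λ x y (G.ne_of_adj he) Δ t hΔ ht

end Summit.AtomisticToContinuum.BoseEinsteinCondensation.Cruxes.GroundStateStability.StableConeVariationalSelection
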